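import Summits.Parity.GeneralizedHardyLittlewood.Theorems.GreenTaoLevelTwoGITwoCyclicInverseBohrDoubling
import Mathlib.Analysis.Complex.Basic

/-!
# Route `GreenTaoLevelTwo`, crux `GITwo` (stmt-Parity-21275), line `birth`, stub `stub_cyclicInverse`:
# averaging on a regular Bohr set (GT08a arXiv Lemma 21 (i)–(iii))

Twenty-fourth helper file toward the XL stub `stub_cyclicInverse` (B. Green, T. Tao, *An inverse
theorem for the Gowers `U³(G)` norm*, arXiv:math/0503014, Thm. 68 = PEMS 51 (2008) Thm. 12.8).
Block B5/B7 of the printed proof: the averaging principle on REGULAR Bohr sets (arXiv Lemma 21,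
§4), the workhorse behind arXiv Lemmas 38, 42 and Props. 43, 45.  Bohr sets are def-free as in the
sibling files; to keep statements short the three Bohr sets `B = B(S,ρ)`, `B⁺ = B(S,(1+ε)ρ)`,
`B⁻ = B(S,(1−ε)ρ)` enter as finsets characterised by their membership condition
(`hB : ∀ x, x ∈ B ↔ ∀ ξ ∈ S, ‖toAddCircle(xξ)‖ < ρ`, …), and regularity (arXiv Def. 16, supplied by
`exists_regular_bohr` of file `…BohrRegular`) enters only through the two card inequalities at
`κ = ±ε` that are used.

* `image_add_sdiff_subset`, `sdiff_image_add_subset` — for `y ∈ B(S, ερ)` (closed ball):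
  `(B + y) ∖ B ⊆ B⁺ ∖ B⁻` and `B ∖ (B + y) ⊆ B⁺ ∖ B⁻`;
* `card_symmDiff_shift_le` — `#((B+y) ∖ B) + #(B ∖ (B+y)) + #B⁻ ≤ #B⁺`;
* `norm_sum_shift_sub_sum_le` — **arXiv Lemma 21 (i), sum form**: for `‖f‖ ≤ 1`,
  `‖Σ_{x∈B} f(x+y) − Σ_{x∈B} f(x)‖ ≤ #B⁺ − #B⁻`;
* `norm_sum_shift_sub_sum_le_of_regular` — the same `≤ 200 d ε #B` under regularity at `κ = ±ε`;
* `norm_sum_sub_sum_avg_le_of_regular` — **arXiv Lemma 21 (ii), sum form**: for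
  `A ⊆ B(S, ερ)`, `‖#A · Σ_{x∈B} f(x) − Σ_{x∈B} Σ_{y∈A} f(x+y)‖ ≤ 200 d ε #A #B`;
* `exists_shift_avg_ge_of_regular` — **arXiv Lemma 21 (iii)** (real `f`): some `x ∈ B` has
  `#B · Σ_{y∈A} f(x+y) ≥ #A · Σ_{y∈B} f(y) − 200 d ε #A #B`.

References: [GreenTao2008U3Inverse] arXiv:math/0503014, Lemma 21 and Def. 16.
-/

noncomputable section

namespace Summit.Parity.GeneralizedHardyLittlewood.GreenTaoLevelTwoGITwoCyclicInverse

open Finset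

variable {N : ℕ} [NeZero N]

section Annulus

variable {S : Finset (ZMod N)} {ρ ε : ℝ} {B Bp Bm : Finset (ZMod N)}
  (hB : ∀ x, x ∈ B ↔ ∀ ξ ∈ S, ‖ZMod.toAddCircle (x * ξ)‖ < ρ)
  (hBp : ∀ x, x ∈ Bp ↔ ∀ ξ ∈ S, ‖ZMod.toAddCircle (x * ξ)‖ < (1 + ε) * ρ)
  (hBm : ∀ x, x ∈ Bm ↔ ∀ ξ ∈ S, ‖ZMod.toAddCircle (x * ξ)‖ < (1 - ε) * ρ)
  {y : ZMod N} (hy : ∀ ξ ∈ S, ‖ZMod.toAddCircle (y * ξ)‖ ≤ ε * ρ)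
include hB hBp hBm hy

/-- `(B + y) ∖ B ⊆ B⁺ ∖ B⁻` for `y ∈ B(S, ερ)`. [cite: GreenTao2008U3Inverse, Lemma 21] -/
theorem image_add_sdiff_subset : B.image (· + y) \ B ⊆ Bp \ Bm := by
  intro x hx
  rw [mem_sdiff, mem_image] at hx
  obtain ⟨⟨b, hb, rfl⟩, hnot⟩ := hx
  rw [mem_sdiff, hBp, hBm]
  refine ⟨fun ξ hξ => ?_, fun hm => hnot ?_⟩
  · rw [add_mul, map_add]
    calc ‖ZMod.toAddCircle (b * ξ) + ZMod.toAddCircle (y * ξ)‖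
        ≤ ‖ZMod.toAddCircle (b * ξ)‖ + ‖ZMod.toAddCircle (y * ξ)‖ := norm_add_le _ _
      _ < ρ + ε * ρ := add_lt_add_of_lt_of_le ((hB b).mp hb ξ hξ) (hy ξ hξ)
      _ = (1 + ε) * ρ := by ring
  · rw [hB]
    intro ξ hξ
    have h1 : ‖ZMod.toAddCircle ((b + y) * ξ)‖ < (1 - ε) * ρ := hm ξ hξ
    have h2 := hy ξ hξ
    have h3 := norm_nonneg (ZMod.toAddCircle (y * ξ))
    linarith

/-- `B ∖ (B + y) ⊆ B⁺ ∖ B⁻` for `y ∈ B(S, ερ)`. [cite: GreenTao2008U3Inverse, Lemma 21] -/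
theorem sdiff_image_add_subset : B \ B.image (· + y) ⊆ Bp \ Bm := by
  intro x hx
  rw [mem_sdiff, mem_image] at hx
  obtain ⟨hxB, hnot⟩ := hx
  rw [mem_sdiff, hBp, hBm]
  have hxB' := (hB x).mp hxB
  refine ⟨fun ξ hξ => ?_, fun hm => hnot ⟨x - y, ?_, sub_add_cancel x y⟩⟩
  · have h1 := hxB' ξ hξ
    have h2 := hy ξ hξ
    have h3 := norm_nonneg (ZMod.toAddCircle (y * ξ))
    linarith
  · rw [hB]
    intro ξ hξ
    rw [sub_mul, map_sub]
    calc ‖ZMod.toAddCircle (x * ξ) - ZMod.toAddCircle (y * ξ)‖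
        ≤ ‖ZMod.toAddCircle (x * ξ)‖ + ‖ZMod.toAddCircle (y * ξ)‖ := norm_sub_le _ _
      _ < (1 - ε) * ρ + ε * ρ := add_lt_add_of_lt_of_le (hm ξ hξ) (hy ξ hξ)
      _ = ρ := by ring

/-- The shift `B + y` differs from `B` in at most `#B⁺ − #B⁻` elements (`y ∈ B(S, ερ)`,
`S` nonempty). [cite: GreenTao2008U3Inverse, Lemma 21] -/
theorem card_symmDiff_shift_le (hS : S.Nonempty) :
    #(B.image (· + y) \ B) + #(B \ B.image (· + y)) + #Bm ≤ #Bp := by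
  classical
  have hdisj : Disjoint (B.image (· + y) \ B) (B \ B.image (· + y)) := disjoint_sdiff_sdiff
  have hsub : (B.image (· + y) \ B).disjUnion (B \ B.image (· + y)) hdisj ⊆ Bp \ Bm := by
    intro x hx
    rw [mem_disjUnion] at hx
    rcases hx with hx | hx
    · exact image_add_sdiff_subset hB hBp hBm hy hx
    · exact sdiff_image_add_subset hB hBp hBm hy hx
  have h1 := card_le_card hsub
  rw [card_disjUnion] at h1
  have hBmBp : Bm ⊆ Bp := by
    obtain ⟨ξ₀, hξ₀⟩ := hS
    have h0 : 0 ≤ ε * ρ := (norm_nonneg _).trans (hy ξ₀ hξ₀)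
    intro x hx
    rw [hBm] at hx
    rw [hBp]
    intro ξ hξ
    have := hx ξ hξ
    linarith
  have h2 := card_sdiff_add_card_eq_card hBmBp
  omega

/-- **arXiv Lemma 21 (i), sum form**: for `‖f‖ ≤ 1` and `y ∈ B(S, ερ)`,
`‖Σ_{x∈B} f(x+y) − Σ_{x∈B} f(x)‖ ≤ #B⁺ − #B⁻`. [cite: GreenTao2008U3Inverse, Lemma 21] -/
theorem norm_sum_shift_sub_sum_le (hS : S.Nonempty) {f : ZMod N → ℂ} (hf : ∀ x, ‖f x‖ ≤ 1) :
    ‖∑ x ∈ B, f (x + y) - ∑ x ∈ B, f x‖ ≤ (#Bp : ℝ) - #Bm := by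
  classical
  have hinj : Set.InjOn (· + y) (B : Set (ZMod N)) := fun a _ b _ h => add_right_cancel h
  rw [← sum_image hinj, ← sum_sdiff_sub_sum_sdiff]
  have hcard := card_symmDiff_shift_le hB hBp hBm hy hS
  have hc : (#(B.image (· + y) \ B) : ℝ) + #(B \ B.image (· + y)) + #Bm ≤ #Bp := by
    exact_mod_cast hcard
  calc ‖∑ x ∈ B.image (· + y) \ B, f x - ∑ x ∈ B \ B.image (· + y), f x‖
      ≤ ‖∑ x ∈ B.image (· + y) \ B, f x‖ + ‖∑ x ∈ B \ B.image (· + y), f x‖ := norm_sub_le _ _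
    _ ≤ ∑ x ∈ B.image (· + y) \ B, ‖f x‖ + ∑ x ∈ B \ B.image (· + y), ‖f x‖ :=
        add_le_add (norm_sum_le _ _) (norm_sum_le _ _)
    _ ≤ ∑ x ∈ B.image (· + y) \ B, (1 : ℝ) + ∑ x ∈ B \ B.image (· + y), (1 : ℝ) :=
        add_le_add (sum_le_sum fun x _ => hf x) (sum_le_sum fun x _ => hf x)
    _ = #(B.image (· + y) \ B) + #(B \ B.image (· + y)) := by simp
    _ ≤ (#Bp : ℝ) - #Bm := by linarith

/-- **arXiv Lemma 21 (i) for a regular Bohr set**: if `#B⁺ ≤ (1 + 100dε) #B` and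
`(1 − 100dε) #B ≤ #B⁻` (regularity, arXiv Def. 16, at `κ = ±ε`), then for `‖f‖ ≤ 1` and
`y ∈ B(S, ερ)`: `‖Σ_{x∈B} f(x+y) − Σ_{x∈B} f(x)‖ ≤ 200 d ε #B`.
[cite: GreenTao2008U3Inverse, Lemma 21 (i)] -/
theorem norm_sum_shift_sub_sum_le_of_regular (hS : S.Nonempty) {d : ℝ}
    (hregp : (#Bp : ℝ) ≤ (1 + 100 * d * ε) * #B) (hregm : (1 - 100 * d * ε) * #B ≤ (#Bm : ℝ))
    {f : ZMod N → ℂ} (hf : ∀ x, ‖f x‖ ≤ 1) :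
    ‖∑ x ∈ B, f (x + y) - ∑ x ∈ B, f x‖ ≤ 200 * d * ε * #B := by
  have h := norm_sum_shift_sub_sum_le hB hBp hBm hy hS hf
  linarith

end Annulus

section Averages

variable {S : Finset (ZMod N)} {ρ ε d : ℝ} {B Bp Bm A : Finset (ZMod N)}
  (hB : ∀ x, x ∈ B ↔ ∀ ξ ∈ S, ‖ZMod.toAddCircle (x * ξ)‖ < ρ)
  (hBp : ∀ x, x ∈ Bp ↔ ∀ ξ ∈ S, ‖ZMod.toAddCircle (x * ξ)‖ < (1 + ε) * ρ)
  (hBm : ∀ x, x ∈ Bm ↔ ∀ ξ ∈ S, ‖ZMod.toAddCircle (x * ξ)‖ < (1 - ε) * ρ)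
  (hS : S.Nonempty) (hA : ∀ y ∈ A, ∀ ξ ∈ S, ‖ZMod.toAddCircle (y * ξ)‖ ≤ ε * ρ)
  (hregp : (#Bp : ℝ) ≤ (1 + 100 * d * ε) * #B) (hregm : (1 - 100 * d * ε) * #B ≤ (#Bm : ℝ))
include hB hBp hBm hS hA hregp hregm

/-- **arXiv Lemma 21 (ii), sum form**: for `A ⊆ B(S, ερ)` and `‖f‖ ≤ 1`,
`‖#A · Σ_{x∈B} f(x) − Σ_{x∈B} Σ_{y∈A} f(x+y)‖ ≤ 200 d ε #A #B`.
[cite: GreenTao2008U3Inverse, Lemma 21 (ii)] -/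
theorem norm_sum_sub_sum_avg_le_of_regular {f : ZMod N → ℂ} (hf : ∀ x, ‖f x‖ ≤ 1) :
    ‖(#A : ℂ) * ∑ x ∈ B, f x - ∑ x ∈ B, ∑ y ∈ A, f (x + y)‖ ≤ 200 * d * ε * #A * #B := by
  rw [sum_comm]
  have hrw : (#A : ℂ) * ∑ x ∈ B, f x - ∑ y ∈ A, ∑ x ∈ B, f (x + y) =
      ∑ y ∈ A, (∑ x ∈ B, f x - ∑ x ∈ B, f (x + y)) := by
    rw [sum_sub_distrib, sum_const, nsmul_eq_mul]
  rw [hrw]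
  calc ‖∑ y ∈ A, (∑ x ∈ B, f x - ∑ x ∈ B, f (x + y))‖
      ≤ ∑ y ∈ A, ‖∑ x ∈ B, f x - ∑ x ∈ B, f (x + y)‖ := norm_sum_le _ _
    _ ≤ ∑ y ∈ A, 200 * d * ε * #B := sum_le_sum fun y hy => by
        rw [norm_sub_rev]
        exact norm_sum_shift_sub_sum_le_of_regular hB hBp hBm (hA y hy) hS hregp hregm hf
    _ = 200 * d * ε * #A * #B := by rw [sum_const, nsmul_eq_mul]; ring

/-- **arXiv Lemma 21 (iii)** (real form): for `A ⊆ B(S, ερ)`, nonempty regular `B` and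
`|f| ≤ 1` there is `x ∈ B` with `#B · Σ_{y∈A} f(x+y) ≥ #A · Σ_{y∈B} f(y) − 200 d ε #A #B`
(i.e. `𝔼_{y ∈ x+A} f ≥ 𝔼_B f − 200dε`). [cite: GreenTao2008U3Inverse, Lemma 21 (iii)] -/
theorem exists_shift_avg_ge_of_regular (hBne : B.Nonempty) {f : ZMod N → ℝ}
    (hf : ∀ x, |f x| ≤ 1) :
    ∃ x ∈ B, (#A : ℝ) * ∑ y ∈ B, f y - 200 * d * ε * #A * #B ≤
      (#B : ℝ) * ∑ y ∈ A, f (x + y) := by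
  -- the complex-valued estimate specialised to a real `f`
  have hfC : ∀ x, ‖((f x : ℝ) : ℂ)‖ ≤ 1 := fun x => by
    rw [Complex.norm_real, Real.norm_eq_abs]; exact hf x
  have h := norm_sum_sub_sum_avg_le_of_regular hB hBp hBm hS hA hregp hregm hfC
  have hre : (#A : ℝ) * ∑ x ∈ B, f x - ∑ x ∈ B, ∑ y ∈ A, f (x + y) ≤
      200 * d * ε * #A * #B := by
    have h1 := (Complex.abs_re_le_norm _).trans h
    simp only [Complex.sub_re, Complex.mul_re, Complex.natCast_re, Complex.natCast_im,
      Complex.re_sum, Complex.ofReal_re, zero_mul, sub_zero] at h1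
    exact (le_abs_self _).trans h1
  -- pigeonhole on the average over `x ∈ B`
  by_contra hne
  push Not at hne
  have hlt : ∑ x ∈ B, (#B : ℝ) * ∑ y ∈ A, f (x + y) <
      ∑ x ∈ B, ((#A : ℝ) * ∑ y ∈ B, f y - 200 * d * ε * #A * #B) :=
    sum_lt_sum_of_nonempty hBne fun x hx => hne x hx
  rw [sum_const, nsmul_eq_mul, ← mul_sum] at hlt
  have hBpos : (0 : ℝ) < #B := by exact_mod_cast hBne.card_pos
  nlinarith

end Averages

end Summit.Parity.GeneralizedHardyLittlewood.GreenTaoLevelTwoGITwoCyclicInverse
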